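import Summits.BirchSwinnertonDyer.BirchSwinnertonDyer.Theorems.ByReductionTypeAtTwoSupersingularFlatReciprocityConstantPrimitive
import Summits.BirchSwinnertonDyer.BirchSwinnertonDyer.Theorems.ByReductionTypeAtTwoSupersingularFlatCapstoneCoprime
import Summits.BirchSwinnertonDyer.BirchSwinnertonDyer.Theorems.ByReductionTypeAtTwoSupersingularFlatCapstoneCongruences
import Summits.BirchSwinnertonDyer.BirchSwinnertonDyer.Theorems.ByReductionTypeAtTwoSupersingularFlatSaturation
import Summits.BirchSwinnertonDyer.BirchSwinnertonDyer.Theorems.ByReductionTypeAtTwoSupersingularFlatZetaPackageSockets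
import Summits.BirchSwinnertonDyer.BirchSwinnertonDyer.Theorems.ByReductionTypeAtTwoSupersingularFlatZetaDivisible
import Summits.BirchSwinnertonDyer.Rank1Residual.P2.EmptyCellsAtTwo
import Summits.BirchSwinnertonDyer.Rank1Residual.GaloisImage.KuriharaSelmerShaBookkeeping
import Literature.NumberTheory.EllipticCurves.Kato2004.IwasawaH1FreeOfNoRationalTorsionProofs
import Literature.NumberTheory.EllipticCurves.IwasawaAlgebraCharIdealProofs
import HarnessLib

/-!
# Route `ByReductionTypeAtTwo` (rung K4), crux `SupersingularRankZeroAtTwo` (item stmt-BirchSwinnertonDyer-19097), line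
# `odd_blind_package` v2.20 → v2.21, stub 2/5 — **THE (α) DOOR**: the F3 assembly (F3a ∧ F3b EXACT ∧ ZL2 of conjunct (8)) from a family of
# classes with levelwise congruences coprime OFF `(2)` and the x-FREE, normalisation-free research conjunct
# **(α) «∃ e ∈ 𝐇¹, Col♭(L e) ∉ 2Λ»** (μ-primitivity of the ♭ Coleman image of the global Iwasawa cohomology `𝐇¹(T₂E)`) + `0 ≤ v₂(ϖ)`
# (cell `bsd-2adic`, seat `bsd-2adic-ss-1` GEN 26 = LEAD of 19097; `--supports 19097`, helper)

HONEST FRAMING (D-0054): THEOREMS ONLY — no definition, no named fact, no instance, no notation, no `sorry`.  It composes tower-1 GEN 70's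
♭-primitivity door ★★★ `SSFlatERL.flatF3_package_of_levelCongruences_of_flatPrimitive` (B1c, p838609) with the LEAD's saturation algebra
(`SSFlatFold.exists_pow_smul_of_exists_not_mem_of_free`, p838710): on the habitat `𝐇¹(T₂E)` is Λ-FREE
(t42 GEN 51 Z3 `SSFlatPackage.moduleFree_iwasawaH1_two`: `E(ℚ)[2] = 0` ← `ρ̄_{E,2}` irreducible ← good supersingular `2`) of rank `≤ 1`, so a non-zero
member `x_{δ₀}` of the family (t42 GEN 52 C2 ★ `SSFlatCap.snd_coleman_ne_zero_of_levelCongruences`) is `(C 2)^e • x'` with `Col♭(L x') ∉ (2)` as soon as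
(α) holds; the family EXTENDED by `x'` (multipliers `C(2^e)·A_δ` for the old members, `A_{δ₀}` for `x'`, common denominator `2^e·d` — the congruences are
homogeneous: `SSFlatCap.pairingSum_map_C_smul`) is ♭-primitive at the new index and still coprime off `(2)` through the ORIGINAL genuine classes, and B1c
concludes.  (α) quantifies over ALL of `I.H`: no rescaling and no choice of the print family can falsify or trivialise it (pen RC-860/861).  Closes NO stub;
19097 stays OPEN on its 5 registered stubs (v2.20 39efd4f3); nothing booked; BSD₂ is proved for no supersingular curve and BSD for no curve by any of this.

References: [Kato2004Asterisque] Thm. 12.4 (2)(3), Thm. 12.5 (4), §13.8, §13.12–13.14 (pp. 228–234); [Sprung2012] Def. 7.1 (p. 1500), Thm. 7.14, 7.16;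
[Sprung2017] Thm. 1.12, Cor. 4.4–4.5; [Mazur1977] Ch. III §5; [BourbakiAC5to7] Ch. VII §1 no. 3.
-/

set_option autoImplicit false
-- the Theorems namespace of this sub repeats the summit name by design (D-0017 nested layout)
set_option linter.dupNamespace false

noncomputable section

open scoped Classical NumberField

open Polynomial

namespace Summit.BirchSwinnertonDyer.BirchSwinnertonDyer.Theorems

namespace SSFlatFold

open NumberField IsDedekindDomain WeierstrassCurve Literature.NumberTheory.EllipticCurves
  Literature.NumberTheory.EllipticCurves.ZpExtension Literature.NumberTheory.EllipticCurves.Sprung2017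
  Literature.NumberTheory.EllipticCurves.Kobayashi2003 Literature.NumberTheory.EllipticCurves.Sprung2012
  Literature.NumberTheory.EllipticCurves.Rank1Residual Literature.NumberTheory.GaloisRepresentations CongruenceSubgroup

variable (W : WeierstrassCurve ℚ) [W.IsElliptic] [W.IsGloballyMinimal] [ContinuousSMul ℤ_[2] (W.tateModule 2)]
  [Module.Free ℤ_[2] (W.tateModule 2)] [Module.Finite ℤ_[2] (W.tateModule 2)]
  {κ : ZpExtension ℚ 2} {γ : Field.absoluteGaloisGroup ℚ} (v : HeightOneSpectrum (𝓞 ℚ))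
  {g : Field.absoluteGaloisGroup (v.adicCompletion ℚ)} {c : ℕ → localPoints W (v.adicCompletion ℚ)}

/-- Scaling a levelwise congruence: `(A, d, q') ↦ (C r·A, r·d, C r·q')` (t42 GEN 52's `SSFlatCap.levelCongruence_smul`, restated here so this
file does not wait for the door file's olean). [folklore] -/
theorem levelCongruence_C_mul {m : ℕ} {A q' Ω P : IwasawaAlgebra 2} {d : ℤ_[2]} {Θ : PowerSeries ℚ_[2]}
    (h : PowerSeries.C ((2 : ℚ_[2]) ^ m) * (iwasawaToPowerSeries 2 A * Θ - iwasawaToPowerSeries 2 (PowerSeries.C d * P)) =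
      iwasawaToPowerSeries 2 (Ω * q')) (r : ℤ_[2]) :
    PowerSeries.C ((2 : ℚ_[2]) ^ m) *
        (iwasawaToPowerSeries 2 (PowerSeries.C r * A) * Θ - iwasawaToPowerSeries 2 (PowerSeries.C (r * d) * P)) =
      iwasawaToPowerSeries 2 (Ω * (PowerSeries.C r * q')) := by
  rw [show (PowerSeries.C (r * d) : IwasawaAlgebra 2) = PowerSeries.C r * PowerSeries.C d from map_mul _ _ _]
  simp only [map_mul] at h ⊢
  linear_combination (iwasawaToPowerSeries 2 (PowerSeries.C r)) * h

/-- ★★★ **THE (α) DOOR: F3a ∧ F3b (EXACT) ∧ ZL2 OF CONJUNCT (8) FROM A COPRIME-OFF-(2) FAMILY, (α) AND `0 ≤ v₂(ϖ)`.**  Binders = tower-1's B1c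
★★★ `SSFlatERL.flatF3_package_of_levelCongruences_of_flatPrimitive` VERBATIM with its one family-dependent hypothesis
`hprim : ∃ i, (J (L (x i))).2 ∉ Ideal.span {C 2}` REPLACED by the x-free (α) `hα : ∃ e : I.H, (J (L e)).2 ∉ Ideal.span {C 2}`; conclusion = Z6's VERBATIM.
PROOF: a member with non-zero multiplier exists (`exists_ne_zero_of_coprime`) and is non-zero (`snd_coleman_ne_zero_of_levelCongruences`); `I.H` is free of rank
`≤ 1`, so that member is `(C 2)^e • x'` with `(J (L x')).2 ∉ (C 2)` (`exists_pow_smul_of_exists_not_mem_of_free`, `IwasawaAlgebra.prime_C`); extend the family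
by `x'` (index `ι ⊕ Unit`; multipliers `C(2^e)·A_i`, `A_{i₀}`; denominator `2^e·d`) — congruences by `levelCongruence_C_mul` (= t42's `levelCongruence_smul`) / `SSFlatCap.pairingSum_map_C_smul`,
coprimality off `(2)` by the original members — and apply B1c with `hprim := ⟨inr (), _⟩`.
[cite: Kato2004Asterisque, Thm. 12.4 (2)(3), Thm. 12.5 (4), §13.12–13.14 (pp. 231–234)] [cite: Sprung2012, Def. 7.1 (p. 1500), Thm. 7.14, 7.16]
[cite: Sprung2017, Thm. 1.12, Cor. 4.4–4.5] -/
theorem flatF3_package_of_levelCongruences_of_flatImage (hss : GoodSS W 2) (hκ : κ.IsCyclotomic)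
    (hγ : κ.IsTopGenerator γ)
    (hg : κ.IsTopGenerator (resGalOfEmb (closureEmb (K := ℚ) (v.adicCompletion ℚ)) g)) {ap : ℤ} (hap : (2 : ℤ) ∣ ap)
    (I : Kato2004.IwasawaH1Data W 2 κ γ) (hrank : Module.rank (IwasawaAlgebra 2) I.H ≤ 1)
    (L : letI := moduleOfGenerator κ (closureEmb (K := ℚ) (v.adicCompletion ℚ)) W hg
      I.H →ₗ[IwasawaAlgebra 2] (localTowerPointsOfEmb κ (closureEmb (K := ℚ) (v.adicCompletion ℚ)) W →+ ℤ_[2]))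
    (J : letI := moduleOfGenerator κ (closureEmb (K := ℚ) (v.adicCompletion ℚ)) W hg
      (localTowerPointsOfEmb κ (closureEmb (K := ℚ) (v.adicCompletion ℚ)) W →+ ℤ_[2]) →ₗ[IwasawaAlgebra 2]
        IwasawaAlgebra 2 × IwasawaAlgebra 2)
    (hJ : ∀ w, IsColemanPair κ (closureEmb (K := ℚ) (v.adicCompletion ℚ)) W ap g c w (J w).1 (J w).2)
    (P : Submodule (IwasawaAlgebra 2) (IwasawaAlgebra 2)) (loc : I.H →ₗ[IwasawaAlgebra 2] P)
    (hloc : ∀ x : I.H, (loc x : IwasawaAlgebra 2) = (J (L x)).2)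
    {N : ℕ} (f : CuspForm (Gamma0 N) 2) (ϖ : ℚ) (Ls Lf : IwasawaAlgebra 2) (hL : IsSprungPair f 2 ap Ls Lf) (hLf : Lf ≠ 0)
    {ι : Type*} (x : ι → I.H) (A : ι → IwasawaAlgebra 2) {d : ℤ_[2]} (hd : d ≠ 0)
    (hE3 : ∀ (i : ι) (n : ℕ), ∃ (m : ℕ) (q : IwasawaAlgebra 2), PowerSeries.C ((2 : ℚ_[2]) ^ m) *
        (iwasawaToPowerSeries 2 (A i) * (((mazurTateElement f 2 n).map (algebraMap ℚ ℚ_[2]) : ℚ_[2][X]) : PowerSeries ℚ_[2]) -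
          iwasawaToPowerSeries 2 (PowerSeries.C d *
            pairingSum W (localTowerPointsOfEmb κ (closureEmb (K := ℚ) (v.adicCompletion ℚ)) W) g n (c n) (L (x i)))) =
      iwasawaToPowerSeries 2 ((((cyclotomicOmega 2 n).map (Int.castRingHom ℤ_[2]) : ℤ_[2][X]) : PowerSeries ℤ_[2]) * q))
    (hcop : ∀ 𝔭 : PrimeSpectrum (IwasawaAlgebra 2), 𝔭.asIdeal.height = 1 →
      PowerSeries.C (2 : ℤ_[2]) ∉ 𝔭.asIdeal → ∃ i, A i ∉ 𝔭.asIdeal ∧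
        Literature.NumberTheory.EllipticCurves.Kato2004.IsEulerSystemClassTwo W hκ I (x i) ∧ x i ≠ 0)
    (hα : ∃ e : I.H, (J (L e)).2 ∉ Ideal.span {(PowerSeries.C (2 : ℤ_[2]) : IwasawaAlgebra 2)})
    (hϖ : 0 ≤ padicValRat 2 ϖ) :
    ∃ (Z : Submodule (IwasawaAlgebra 2) I.H) (G : IwasawaAlgebra 2),
      G ∈ Submodule.map (P.subtype ∘ₗ loc) Z ∧
      iwasawaToPowerSeries 2 G = PowerSeries.C (ϖ : ℚ_[2]) * iwasawaToPowerSeries 2 Lf ∧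
      (∃ s₀ : I.H, Z = Submodule.span (IwasawaAlgebra 2) {s₀} ∧
        ∀ 𝔭 : PrimeSpectrum (IwasawaAlgebra 2), 𝔭.asIdeal.height = 1 →
          PowerSeries.C (2 : ℤ_[2]) ∉ 𝔭.asIdeal →
          ∃ (M : IwasawaAlgebra 2) (s : I.H), M ∉ 𝔭.asIdeal ∧
            Literature.NumberTheory.EllipticCurves.Kato2004.IsEulerSystemClassTwo W hκ I s ∧ s ≠ 0 ∧
            M • s₀ = s) := by
  letI := moduleOfGenerator κ (closureEmb (K := ℚ) (v.adicCompletion ℚ)) W hg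
  haveI : Module.Free (IwasawaAlgebra 2) I.H := SSFlatPackage.moduleFree_iwasawaH1_two W hss hκ hγ I
  -- the bare coprimality and a member `x i₀ ≠ 0`
  have hcop' : ∀ 𝔭 : PrimeSpectrum (IwasawaAlgebra 2), 𝔭.asIdeal.height = 1 →
      PowerSeries.C ((2 : ℕ) : ℤ_[2]) ∉ 𝔭.asIdeal → ∃ i, A i ∉ 𝔭.asIdeal := fun 𝔭 h𝔭 hm ↦ by
    obtain ⟨i, hi, -, -⟩ := hcop 𝔭 h𝔭 (by simpa using hm)
    exact ⟨i, hi⟩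
  obtain ⟨i₀, hA0⟩ := SSFlatPackage.exists_ne_zero_of_coprime A hcop'
  have hap' : ((2 : ℕ) : ℤ) ∣ ap := by simpa using hap
  have hE3' : ∀ (i : ι) (n : ℕ), ∃ (m : ℕ) (q : IwasawaAlgebra 2), PowerSeries.C (((2 : ℕ) : ℚ_[2]) ^ m) *
        (iwasawaToPowerSeries 2 (A i) * (((mazurTateElement f 2 n).map (algebraMap ℚ ℚ_[2]) : ℚ_[2][X]) : PowerSeries ℚ_[2]) -
          iwasawaToPowerSeries 2 (PowerSeries.C d *
            pairingSum W (localTowerPointsOfEmb κ (closureEmb (K := ℚ) (v.adicCompletion ℚ)) W) g n (c n) (L (x i)))) =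
      iwasawaToPowerSeries 2 ((((cyclotomicOmega 2 n).map (Int.castRingHom ℤ_[2]) : ℤ_[2][X]) : PowerSeries ℤ_[2]) * q) :=
    fun i n ↦ by simpa only [Nat.cast_ofNat] using hE3 i n
  obtain ⟨-, hx0⟩ := SSFlatCap.snd_coleman_ne_zero_of_levelCongruences hg hap' L J hJ x A hd hcop' f hL hLf hE3' hA0
  -- saturation of `x i₀` at `(2)` with the (α) witness
  have hr2 : Prime (PowerSeries.C (2 : ℤ_[2]) : IwasawaAlgebra 2) := by
    simpa using Literature.NumberTheory.EllipticCurves.IwasawaAlgebra.prime_C 2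
  obtain ⟨e, x', hxe, hx'⟩ := exists_pow_smul_of_exists_not_mem_of_free (R := IwasawaAlgebra 2) (M := I.H) hrank hr2
    ((LinearMap.snd (IwasawaAlgebra 2) (IwasawaAlgebra 2) (IwasawaAlgebra 2)) ∘ₗ J ∘ₗ L) hα hx0
  have hx'flat : (J (L x')).2 ∉ Ideal.span {(PowerSeries.C (2 : ℤ_[2]) : IwasawaAlgebra 2)} := hx'
  have hCpow : (PowerSeries.C (2 : ℤ_[2]) : IwasawaAlgebra 2) ^ e = PowerSeries.C ((2 : ℤ_[2]) ^ e) := (map_pow _ _ _).symm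
  -- the extended family on `ι ⊕ Unit`
  let x₁ : ι ⊕ Unit → I.H := Sum.elim x fun _ ↦ x'
  let A₁ : ι ⊕ Unit → IwasawaAlgebra 2 := Sum.elim (fun i ↦ PowerSeries.C ((2 : ℤ_[2]) ^ e) * A i) fun _ ↦ A i₀
  have hd₁ : (2 : ℤ_[2]) ^ e * d ≠ 0 := mul_ne_zero (pow_ne_zero _ two_ne_zero) hd
  have hE3₁ : ∀ (i : ι ⊕ Unit) (n : ℕ), ∃ (m : ℕ) (q : IwasawaAlgebra 2), PowerSeries.C ((2 : ℚ_[2]) ^ m) *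
        (iwasawaToPowerSeries 2 (A₁ i) * (((mazurTateElement f 2 n).map (algebraMap ℚ ℚ_[2]) : ℚ_[2][X]) : PowerSeries ℚ_[2]) -
          iwasawaToPowerSeries 2 (PowerSeries.C ((2 : ℤ_[2]) ^ e * d) *
            pairingSum W (localTowerPointsOfEmb κ (closureEmb (K := ℚ) (v.adicCompletion ℚ)) W) g n (c n) (L (x₁ i)))) =
      iwasawaToPowerSeries 2 ((((cyclotomicOmega 2 n).map (Int.castRingHom ℤ_[2]) : ℤ_[2][X]) : PowerSeries ℤ_[2]) * q) := by
    rintro (i | u) n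
    · -- old member: scale the congruence by `C(2^e)`
      obtain ⟨m, q, h⟩ := hE3 i n
      exact ⟨m, PowerSeries.C ((2 : ℤ_[2]) ^ e) * q, levelCongruence_C_mul h ((2 : ℤ_[2]) ^ e)⟩
    · -- the saturated member: `x i₀ = (C 2)^e • x'` moves `2^e` onto the denominator
      obtain ⟨m, q, h⟩ := hE3 i₀ n
      refine ⟨m, q, ?_⟩
      have hP : PowerSeries.C d *
            pairingSum W (localTowerPointsOfEmb κ (closureEmb (K := ℚ) (v.adicCompletion ℚ)) W) g n (c n) (L (x i₀)) =
          PowerSeries.C ((2 : ℤ_[2]) ^ e * d) *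
            pairingSum W (localTowerPointsOfEmb κ (closureEmb (K := ℚ) (v.adicCompletion ℚ)) W) g n (c n) (L x') := by
        rw [hxe, hCpow, SSFlatCap.pairingSum_map_C_smul κ (closureEmb (K := ℚ) (v.adicCompletion ℚ)) W hg L g n (c n) ((2 : ℤ_[2]) ^ e) x', ← mul_assoc, ← map_mul, mul_comm d]
      simpa only [x₁, A₁, Sum.elim_inr, hP] using h
  have hcop₁ : ∀ 𝔭 : PrimeSpectrum (IwasawaAlgebra 2), 𝔭.asIdeal.height = 1 →
      PowerSeries.C (2 : ℤ_[2]) ∉ 𝔭.asIdeal → ∃ i, A₁ i ∉ 𝔭.asIdeal ∧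
        Literature.NumberTheory.EllipticCurves.Kato2004.IsEulerSystemClassTwo W hκ I (x₁ i) ∧ x₁ i ≠ 0 := by
    intro 𝔭 h𝔭 h2
    obtain ⟨i, hi, hES, hne⟩ := hcop 𝔭 h𝔭 h2
    refine ⟨Sum.inl i, ?_, hES, hne⟩
    -- `C(2^e)·A i ∉ 𝔭`: `𝔭` prime, `C 2 ∉ 𝔭`
    intro hmem
    rcases 𝔭.isPrime.mem_or_mem hmem with h | h
    · rw [← hCpow] at h
      exact h2 (𝔭.isPrime.mem_of_pow_mem e h)
    · exact hi h
  exact SSFlatERL.flatF3_package_of_levelCongruences_of_flatPrimitive W v hss hκ hγ hg hap I hrank L J hJ P loc hloc f ϖ Ls Lf hL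
    hLf x₁ A₁ hd₁ hE3₁ hcop₁ ⟨Sum.inr (), hx'flat⟩ hϖ

/-- ★★★ **THE (α) DOOR IN THE REGISTERED CURRENCY** — the same with the conclusion LITERALLY the f-block body of `FlatZetaPackageAtTwo`
(`∃ Z G, (∃ z ∈ Z, (J (L z)).2 = G) ∧ ι G = C ϖ · ι L♭ ∧ ZL2`; `P := ⊤`, `loc := codRestrict ⊤ (LinearMap.snd ∘ₗ J ∘ₗ L)`).
[cite: Kato2004Asterisque, Thm. 12.5 (4), §13.12–13.14 (pp. 231–234)] [cite: Sprung2012, Def. 7.1 (p. 1500), Thm. 7.14, 7.16] -/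
theorem flatZeta_fblock_of_levelCongruences_of_flatImage (hss : GoodSS W 2) (hκ : κ.IsCyclotomic)
    (hγ : κ.IsTopGenerator γ)
    (hg : κ.IsTopGenerator (resGalOfEmb (closureEmb (K := ℚ) (v.adicCompletion ℚ)) g)) {ap : ℤ} (hap : (2 : ℤ) ∣ ap)
    (I : Kato2004.IwasawaH1Data W 2 κ γ) (hrank : Module.rank (IwasawaAlgebra 2) I.H ≤ 1)
    (L : letI := moduleOfGenerator κ (closureEmb (K := ℚ) (v.adicCompletion ℚ)) W hg
      I.H →ₗ[IwasawaAlgebra 2] (localTowerPointsOfEmb κ (closureEmb (K := ℚ) (v.adicCompletion ℚ)) W →+ ℤ_[2]))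
    (J : letI := moduleOfGenerator κ (closureEmb (K := ℚ) (v.adicCompletion ℚ)) W hg
      (localTowerPointsOfEmb κ (closureEmb (K := ℚ) (v.adicCompletion ℚ)) W →+ ℤ_[2]) →ₗ[IwasawaAlgebra 2]
        IwasawaAlgebra 2 × IwasawaAlgebra 2)
    (hJ : ∀ w, IsColemanPair κ (closureEmb (K := ℚ) (v.adicCompletion ℚ)) W ap g c w (J w).1 (J w).2)
    {N : ℕ} (f : CuspForm (Gamma0 N) 2) (ϖ : ℚ) (Ls Lf : IwasawaAlgebra 2) (hL : IsSprungPair f 2 ap Ls Lf) (hLf : Lf ≠ 0)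
    {ι : Type*} (x : ι → I.H) (A : ι → IwasawaAlgebra 2) {d : ℤ_[2]} (hd : d ≠ 0)
    (hE3 : ∀ (i : ι) (n : ℕ), ∃ (m : ℕ) (q : IwasawaAlgebra 2), PowerSeries.C ((2 : ℚ_[2]) ^ m) *
        (iwasawaToPowerSeries 2 (A i) * (((mazurTateElement f 2 n).map (algebraMap ℚ ℚ_[2]) : ℚ_[2][X]) : PowerSeries ℚ_[2]) -
          iwasawaToPowerSeries 2 (PowerSeries.C d *
            pairingSum W (localTowerPointsOfEmb κ (closureEmb (K := ℚ) (v.adicCompletion ℚ)) W) g n (c n) (L (x i)))) =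
      iwasawaToPowerSeries 2 ((((cyclotomicOmega 2 n).map (Int.castRingHom ℤ_[2]) : ℤ_[2][X]) : PowerSeries ℤ_[2]) * q))
    (hcop : ∀ 𝔭 : PrimeSpectrum (IwasawaAlgebra 2), 𝔭.asIdeal.height = 1 →
      PowerSeries.C (2 : ℤ_[2]) ∉ 𝔭.asIdeal → ∃ i, A i ∉ 𝔭.asIdeal ∧
        Literature.NumberTheory.EllipticCurves.Kato2004.IsEulerSystemClassTwo W hκ I (x i) ∧ x i ≠ 0)
    (hα : ∃ e : I.H, (J (L e)).2 ∉ Ideal.span {(PowerSeries.C (2 : ℤ_[2]) : IwasawaAlgebra 2)})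
    (hϖ : 0 ≤ padicValRat 2 ϖ) :
    ∃ (Z : Submodule (IwasawaAlgebra 2) I.H) (G : IwasawaAlgebra 2),
      (∃ z ∈ Z, (J (L z)).2 = G) ∧
      iwasawaToPowerSeries 2 G = PowerSeries.C (ϖ : ℚ_[2]) * iwasawaToPowerSeries 2 Lf ∧
      (∃ s₀ : I.H, Z = Submodule.span (IwasawaAlgebra 2) {s₀} ∧
        ∀ 𝔭 : PrimeSpectrum (IwasawaAlgebra 2), 𝔭.asIdeal.height = 1 →
          PowerSeries.C (2 : ℤ_[2]) ∉ 𝔭.asIdeal →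
          ∃ (M : IwasawaAlgebra 2) (s : I.H), M ∉ 𝔭.asIdeal ∧
            Literature.NumberTheory.EllipticCurves.Kato2004.IsEulerSystemClassTwo W hκ I s ∧ s ≠ 0 ∧
            M • s₀ = s) := by
  letI := moduleOfGenerator κ (closureEmb (K := ℚ) (v.adicCompletion ℚ)) W hg
  obtain ⟨Z, G, hG, hF3b, hZL⟩ := flatF3_package_of_levelCongruences_of_flatImage W v hss hκ hγ hg hap I hrank L J hJ ⊤
    (LinearMap.codRestrict (⊤ : Submodule (IwasawaAlgebra 2) (IwasawaAlgebra 2))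
      ((LinearMap.snd (IwasawaAlgebra 2) (IwasawaAlgebra 2) (IwasawaAlgebra 2)) ∘ₗ J ∘ₗ L) (fun _ ↦ Submodule.mem_top))
    (fun _ ↦ rfl) f ϖ Ls Lf hL hLf x A hd hE3 hcop hα hϖ
  exact ⟨Z, G, exists_mem_snd_eq_of_mem_map_codRestrict L J Z G hG, hF3b, hZL⟩

end SSFlatFold

end Summit.BirchSwinnertonDyer.BirchSwinnertonDyer.Theorems

end
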